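import Mathlib
import Literature.MathematicalPhysics.QuantumFieldTheory.Balaban1983to89.B12StepObligation

/-!
# `Balaban1983to89.B12BetaSmooth` — the g-regularity clauses of [Balaban1987RG1] §1 (p. 263 clause on `E^{(j)}`,
p. 264 β-clause, p. 266 analytic alternative), and the KERNEL derivative-interchange for (1.22)

CITATION HEADER (lean-in-tree rule 2026-08-18).  Source: T. Bałaban, *Renormalization group approach to lattice gauge
field theories. I. Generation of effective actions in a small field approximation and a coupling constant
renormalization in four dimensions*, Commun. Math. Phys. **109**, 249–301 (1987), doi:10.1007/bf01215223
[Balaban1987RG1] (cell paper B12; held `paper:balaban1987-cmp109-rg-i-small-field`; journal page = PDF page + 248; every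
sentence quoted below was read from the page renders `…/1987-cmp109-rg-I-small-field-p015/p016/p018/p021/p045/p049/p050-x2.png`
under `HOME/b2b-balaban-ref1/pages/`, not from the OCR layer).  Locators: p. 263 [PDF 15] (the clause on `E^{(j)}` and (1.18)), p. 264 [PDF 16] ((1.20)–(1.22), the
β-clause, Theorem 3), p. 266 [PDF 18] (the alternative restriction `g_k/γ_k ε₁`), p. 293 [PDF 45] ((5.10)), p. 297 [PDF 49]
((5.42)), p. 298 [PDF 50] (history dependence of `β_j`).

WHAT THIS MODULE DOES (audit cell `pub-balaban`, surge node `b2b-balaban-pv20`, claim `G-adv2-6-BETASMOOTH-KERNEL`; a NEW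
satellite of `B12StepObligation`, nothing landed is modified).  Value = typed skeleton + located gap, NOT summit progress;
nothing of the series is asserted — every `def … : Prop` / `structure` below is consumed only as a hypothesis, every
`theorem` is kernel-checked bookkeeping or elementary real analysis.

* Part 1 — THE PRINTED g-REGULARITY CLAUSES, VERBATIM.  p. 263, of the localized terms: *"We assume that the function
  E^{(j)}(X, g_{j−1}, 𝐔, 𝐉) is defined and analytic on the space U^c_j(X, α₀, α₁) … It is a C^∞-function of g_{j−1} ∈ [0, γ],
  (or analytic), with a positive, absolute γ."* — the clause (i) that `Step.SFHyp` does NOT carry (cell GAPS.md G-adv2-6 (i),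
  G-b12-2 (i); `Step` docstring, DIVERGENCE D-f2.1) — typed over the small-field tower `Step.SFTower` in the shape of the
  `SFHyp` clauses (`ESmoothHyp`, all terms `j = 1, …, k`) and at the new index (`ESmoothAt`, the shape of a `Step.SFNewTerm`
  clause), with the cumulative bookkeeping `eSmoothHyp_succ_iff`.  p. 266: *"Another possibility is to take g_k/γ_k ε₁
  instead of ε₁, where γ_k = C log(L^k ε)^{−1} with C sufficiently large. It has the advantage that the functions E^{(j)}, β_j
  are analytic functions of the effective coupling constants, but it has some disadvantages in perturbative calculations
  also. We have formulated the implications of both possibilities in the inductive description."* — the "(or analytic)"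
  alternative, typed as within-set real analyticity on `[0, γ]` (`EAnalyticAt`, `BetaAnalyticAt`; the weakest faithful
  reading, one-sided at the endpoints) with the kernel-checked links "(or analytic) ⇒ C^∞" (`eSmoothAt_of_analytic`,
  `betaSmoothAt_of_analytic`, Mathlib `AnalyticOn.contDiffOn` on `[0, γ]`, `γ > 0`).

* Part 2 — WHAT THE β-CLAUSE WOULD NEED, TYPED AS LOCATED OPEN INPUTS (unprinted; named by cell GAPS.md G-adv2-6 as
  *"Needed: an inductive clause bounding ∂^n_g E^{(j)}(X) (or analyticity in g on a j-independent complex neighbourhood of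
  [0,γ]) and its propagation through (2.13)–(2.41)"*, cf. G-b12-2):
  `EDerivBound118` = (1.18) p. 263 WITH ALL g-DERIVATIVES (`‖∂ⁿ_g E^{(j)}(X, g, 𝐔, 𝐉)‖ ≤ E₀,ₙ e^{−κ d_j(X)}` on
  `U^c_j(X, α₀, α₁)`, `g ∈ [0, γ]`; its `n = 0` instance IS (1.18): `bound118_of_derivBound`), and `PiSmoothSource` = the §5
  source `B12StepObligation.Beta542Source` ((5.42) + (5.10)) EXTENDED by smoothness in `g` of the vacuum-polarization kernel
  `Π^{(k+1)}_{μν}(g, x)` of (1.20)–(1.21) with (5.10)-type decay of every g-derivative, `|∂ⁿ_g Π(g, x)| ≤ Cₙ e^{−δ₁|x|₁}`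
  uniformly in `g ∈ [0, γ]`.  The passage `EDerivBound118 ⇒ PiSmoothSource` — commuting `∂ⁿ_g` with the second variational
  derivative `δ²/δB δB` at `B = 0` of (1.20) (a Cauchy estimate on `U^c_{k+1}`) and with the limit `T^{(k+1)} ↗ ℤ^d` of
  (1.21) (*"This limit exists by the localized representation (1.7)"*, a polymer sum) — is NOT typed (no linear structure on
  the abstract configuration type `Φ`, no lattice Fourier analysis in this package): it is the ONE named hypothesis
  `PolarizationDerivTransfer` of the end-to-end statement `betaClauses_of_transfer`.  §5 of [I] ASSERTS its `n = 0` instance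
  ((5.10) p. 293: *"The representation (4.37) yields the following inequality"* — asserted from (4.37) and (1.18), not
  derived in print: cell GAPS G-B12s-15, G-pv13-4) and says nothing about `n ≥ 1`; [II] =
  [Balaban1988RG2Cluster] pp. 19–22 does not mention g-dependence (G-adv2-6).  This is the precise open statement of what
  B12/B13 would have to carry through the induction for the p. 264 β-clause; NO claim that they do.

* Part 3 — KERNEL: DIFFERENTIATION UNDER THE LATTICE SUM (1.22) ON THE CLOSED INTERVAL.  Generic real analysis
  (`DominatedSmoothFamily`, `hasDerivWithinAt_tsum_Icc`, `contDiffOn_tsum_Icc`, `iteratedDerivWithin_tsum_Icc`,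
  `abs_iteratedDerivWithin_tsum_le`): a series `Σ_i f_i(g)` of functions each `C^∞` on `[a, b]` whose m-th derivatives
  within `[a, b]` are dominated by summable sequences `v_m` is `C^∞` on `[a, b]` (one-sided at the endpoints, i.e. in the
  sense of `ContDiffOn ℝ n · (Set.Icc a b)` used by `Step.SFHyp.betaSmooth`), with `∂^m Σ = Σ ∂^m` and `|∂^m Σ| ≤ Σ_i v_m(i)`.
  Mathlib has the whole-space version (`contDiff_tsum`) and the open-set first-derivative version
  (`hasDerivAt_tsum_of_isPreconnected`); the closed-interval version is assembled here from the latter (interior) and the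
  endpoint-extension lemmas `hasDerivWithinAt_Ici/Iic_of_tendsto_deriv`, then by induction on the order.  Applied to
  (1.22) = (5.42) *"β = Σ_x Π_{μν}(x) x_μ x_ν … This is the fundamental equality defining the β-function"*:
  `PiSmoothSource ⇒ BetaSmoothAt` (`betaSmoothAt_of_piSmooth`: the SHAPE of `Step.SFNewTerm.betaSmooth` /
  `B12StepObligation.BetaSmoothAt` discharged from the located Π-input), `⇒ BetaDerivBoundsAt` with the explicit constants
  `β′ₙ = Cₙ · Σ_x |x|₁² e^{−δ₁|x|₁} = B12Sec2to5.betaPrime510 d Cₙ δ₁` (`betaDerivBounds_of_piSmooth`: the derivative half of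
  *"uniformly bounded on this interval together with all derivatives"*, which the cell had left untyped — DIVERGENCE D-f2.5
  — now TYPED as `BetaDerivBoundsAt`), and the mean-value consequence `|β_{k+1}(g) − β_{k+1}(0)| ≤ β′₁ g` on `[0, γ]`
  (`lipschitzAtZero_of_derivBound`, `betaLipschitzAtZero_of_piSmooth`) = the shape of the hypothesis (AF-1) of
  `B12Beta.betaLower_of_split` / `af1_of_vanish_lipschitz` (Markov typing, `r_j(x) = β_j(x) − β_j(0)`; GAPS G-b12-1).

TYPING NOTES.  (1) All g-regularity is typed WITHIN `Set.Icc 0 c.γ` (`ContDiffOn`, `iteratedDerivWithin`, `AnalyticOn`), as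
print has `g_{j−1} ∈ [0, γ]` and as `Step.SFHyp.betaSmooth` does; the kernel family `Pk : ℝ → B12Beta.Kernel d` is given at
every real `g` (typing convention of `Beta542Source`, DIVERGENCE D-b03.5) but constrained only on `[0, γ]`; `0 < γ` (print:
*"a positive, absolute γ"*) is the hypothesis making `[0, γ]` a set of unique differentiability.  (2) p. 298: *"We write β_j as
explicitly dependent on g_{j−1}, although it depends also on all preceding coupling constants."* — as in `Step`/`B12StepObligation`
the history is suppressed (one tower per history; Markov typing D-f2.4/G-adv2-4); uniformity of the constants `Cₙ`, `β′ₙ` in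
`k` and in the history is expressed only by their being fields/arguments not depending on `k`.  (3) Nothing here bears on the
SIGN of β (asymptotic freedom: (AF-0) of GAPS G-b12-1 = (M2) of `HOME/MISSING.md` §A1 strat-b12 addendum); the module concerns the
g-REGULARITY side only ((M1) there = *"a k-uniform O(g_k) bound on β¹ (the unproved p. 264 derivative clause)"*, whose SHAPE in
Markov typing is `betaLipschitzAtZero_of_piSmooth`).  Unit `b2b-balaban-pv20`; records `HOME/GAPS.md` G-pv20-1 (located open input `PolarizationDerivTransfer`
/ `EDerivBound118`), C-pv20-1 (kernel certification of the (1.22) interchange), `HOME/DIVERGENCE.md` D-pv20.1–2.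
-/

open Set Filter Topology

namespace Literature.MathematicalPhysics.QuantumFieldTheory.Balaban1983to89.B12BetaSmooth

open Literature.MathematicalPhysics.QuantumFieldTheory.Balaban1983to89
open Literature.MathematicalPhysics.QuantumFieldTheory.Balaban1983to89.Step
open Literature.MathematicalPhysics.QuantumFieldTheory.Balaban1983to89.B12StepObligation

/-! ## Part 3 (placed first: no tower needed) — differentiation under a dominated series on a closed interval -/

section SmoothSeries

variable {ι : Type*} {a b : ℝ}

/-- A DOMINATED SMOOTH FAMILY on `[a, b]`: every term `f i` is `C^m` on `[a, b]` for every `m : ℕ` (one-sided at the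
endpoints: `ContDiffOn … (Set.Icc a b)`), and its `m`-th derivative within `[a, b]` is bounded on `[a, b]` by `v m i` with
`Σ_i v m i < ∞` for every `m`.  (The hypotheses of the closed-interval term-by-term differentiation theorem.) [folklore] -/
structure DominatedSmoothFamily (a b : ℝ) (f : ι → ℝ → ℝ) (v : ℕ → ι → ℝ) : Prop where
  summable : ∀ m, Summable (v m)
  smooth : ∀ i (m : ℕ), ContDiffOn ℝ m (f i) (Set.Icc a b)
  bound : ∀ m i, ∀ y ∈ Set.Icc a b, |iteratedDerivWithin m (f i) (Set.Icc a b) y| ≤ v m i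

namespace DominatedSmoothFamily

variable {f : ι → ℝ → ℝ} {v : ℕ → ι → ℝ}

/-- Order 0 of the domination: `|f i y| ≤ v 0 i` on `[a, b]`. [folklore] -/
theorem bound_zero (h : DominatedSmoothFamily a b f v) : ∀ i, ∀ y ∈ Set.Icc a b, |f i y| ≤ v 0 i := by
  intro i y hy
  have := h.bound 0 i y hy
  rwa [iteratedDerivWithin_zero] at this

/-- Order 1 of the domination: `|(f i)′ y| ≤ v 1 i` on `[a, b]` (derivative within `[a, b]`). [folklore] -/
theorem bound_one (h : DominatedSmoothFamily a b f v) :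
    ∀ i, ∀ y ∈ Set.Icc a b, |derivWithin (f i) (Set.Icc a b) y| ≤ v 1 i := by
  intro i y hy
  have := h.bound 1 i y hy
  rwa [iteratedDerivWithin_one] at this

/-- Each term is `C¹` on `[a, b]`. [folklore] -/
theorem contDiffOn_one (h : DominatedSmoothFamily a b f v) (i : ι) : ContDiffOn ℝ 1 (f i) (Set.Icc a b) := by
  exact_mod_cast h.smooth i 1

/-- The family of derivatives (within `[a, b]`) of a dominated smooth family is again one, with the bounds shifted by one
order (`a < b` makes `[a, b]` a set of unique differentiability). [folklore] -/
theorem derivFamily (hab : a < b) (h : DominatedSmoothFamily a b f v) :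
    DominatedSmoothFamily a b (fun i => derivWithin (f i) (Set.Icc a b)) (fun m => v (m + 1)) where
  summable := fun m => h.summable (m + 1)
  smooth := fun i m => (h.smooth i (m + 1)).derivWithin (uniqueDiffOn_Icc hab) (Nat.cast_succ m).symm.le
  bound := fun m i y hy => by
    have := h.bound (m + 1) i y hy
    rwa [iteratedDerivWithin_succ'] at this

/-- The series `g ↦ Σ_i f i g` of a dominated smooth family is summable at every point of `[a, b]`. [folklore] -/
theorem summable_at (h : DominatedSmoothFamily a b f v) {y : ℝ} (hy : y ∈ Set.Icc a b) :
    Summable (fun i => f i y) :=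
  Summable.of_norm_bounded (h.summable 0) (fun i => by rw [Real.norm_eq_abs]; exact h.bound_zero i y hy)

/-- The series is continuous on `[a, b]` (uniform convergence). [folklore] -/
theorem continuousOn_tsum (h : DominatedSmoothFamily a b f v) :
    ContinuousOn (fun z => ∑' i, f i z) (Set.Icc a b) :=
  _root_.continuousOn_tsum (fun i => (h.smooth i 0).continuousOn) (h.summable 0)
    (fun i y hy => by rw [Real.norm_eq_abs]; exact h.bound_zero i y hy)

/-- **TERM-BY-TERM DIFFERENTIATION WITHIN A CLOSED INTERVAL.**  For a dominated smooth family on `[a, b]`, `a < b`, the series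
`z ↦ Σ_i f i z` has, at every point `y ∈ [a, b]`, the derivative `Σ_i (f i)′(y)` WITHIN `[a, b]` (one-sided at the endpoints).
Interior points: Mathlib's `hasDerivAt_tsum_of_isPreconnected` on `]a, b[`; endpoints: the derivative series is continuous on
`[a, b]` by uniform convergence, so `hasDerivWithinAt_Ici/Iic_of_tendsto_deriv` extend the derivative to `a` and `b`. [folklore] -/
theorem hasDerivWithinAt_tsum (hab : a < b) (h : DominatedSmoothFamily a b f v) :
    ∀ y ∈ Set.Icc a b, HasDerivWithinAt (fun z => ∑' i, f i z)
      (∑' i, _root_.derivWithin (f i) (Set.Icc a b) y) (Set.Icc a b) y := by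
  have hs : UniqueDiffOn ℝ (Set.Icc a b) := uniqueDiffOn_Icc hab
  -- continuity of the series and of the derivative series on [a, b]
  have hFc : ContinuousOn (fun z => ∑' i, f i z) (Set.Icc a b) := h.continuousOn_tsum
  have hGc : ContinuousOn (fun z => ∑' i, _root_.derivWithin (f i) (Set.Icc a b) z) (Set.Icc a b) :=
    _root_.continuousOn_tsum (fun i => (h.contDiffOn_one i).continuousOn_derivWithin hs le_rfl) (h.summable 1)
      (fun i y hy => by rw [Real.norm_eq_abs]; exact h.bound_one i y hy)
  -- interior points
  have hmid : (a + b) / 2 ∈ Set.Ioo a b := by constructor <;> linarith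
  have hint : ∀ y ∈ Set.Ioo a b,
      HasDerivAt (fun z => ∑' i, f i z) (∑' i, _root_.derivWithin (f i) (Set.Icc a b) y) y := by
    intro y hy
    refine hasDerivAt_tsum_of_isPreconnected (h.summable 1) isOpen_Ioo isPreconnected_Ioo
      (fun i z hz => ?_) (fun i z hz => ?_) hmid (h.summable_at (Ioo_subset_Icc_self hmid)) hy
    · have hsz : Set.Icc a b ∈ 𝓝 z := Icc_mem_nhds hz.1 hz.2
      have hd : DifferentiableAt ℝ (f i) z :=
        (((h.contDiffOn_one i).differentiableOn one_ne_zero) z (Ioo_subset_Icc_self hz)).differentiableAt hsz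
      rw [derivWithin_of_mem_nhds hsz]
      exact hd.hasDerivAt
    · rw [Real.norm_eq_abs]
      exact h.bound_one i z (Ioo_subset_Icc_self hz)
  have hdiff : DifferentiableOn ℝ (fun z => ∑' i, f i z) (Set.Ioo a b) :=
    fun z hz => (hint z hz).differentiableAt.differentiableWithinAt
  -- the three cases
  intro y hy
  rcases eq_or_lt_of_le hy.1 with hya | hya
  · -- left endpoint y = a
    rw [← hya]
    have ha : a ∈ Set.Icc a b := ⟨le_rfl, hab.le⟩
    have hlim : ContinuousWithinAt (fun z => ∑' i, f i z) (Set.Ioo a b) a := (hFc a ha).mono Ioo_subset_Icc_self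
    have hGa : ContinuousWithinAt (fun z => ∑' i, _root_.derivWithin (f i) (Set.Icc a b) z) (Set.Ioi a) a :=
      (hGc a ha).mono_of_mem_nhdsWithin (mem_of_superset (Ioo_mem_nhdsGT hab) Ioo_subset_Icc_self)
    have hlim' : Tendsto (fun z => deriv (fun z => ∑' i, f i z) z) (𝓝[>] a)
        (𝓝 (∑' i, _root_.derivWithin (f i) (Set.Icc a b) a)) := by
      refine hGa.tendsto.congr' ?_
      filter_upwards [Ioo_mem_nhdsGT hab] with z hz using ((hint z hz).deriv).symm
    exact (hasDerivWithinAt_Ici_of_tendsto_deriv hdiff hlim (Ioo_mem_nhdsGT hab) hlim').mono Icc_subset_Ici_self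
  rcases eq_or_lt_of_le hy.2 with hyb | hyb
  · -- right endpoint y = b
    rw [hyb]
    have hb : b ∈ Set.Icc a b := ⟨hab.le, le_rfl⟩
    have hlim : ContinuousWithinAt (fun z => ∑' i, f i z) (Set.Ioo a b) b := (hFc b hb).mono Ioo_subset_Icc_self
    have hGb : ContinuousWithinAt (fun z => ∑' i, _root_.derivWithin (f i) (Set.Icc a b) z) (Set.Iio b) b :=
      (hGc b hb).mono_of_mem_nhdsWithin (mem_of_superset (Ioo_mem_nhdsLT hab) Ioo_subset_Icc_self)
    have hlim' : Tendsto (fun z => deriv (fun z => ∑' i, f i z) z) (𝓝[<] b)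
        (𝓝 (∑' i, _root_.derivWithin (f i) (Set.Icc a b) b)) := by
      refine hGb.tendsto.congr' ?_
      filter_upwards [Ioo_mem_nhdsLT hab] with z hz using ((hint z hz).deriv).symm
    exact (hasDerivWithinAt_Iic_of_tendsto_deriv hdiff hlim (Ioo_mem_nhdsLT hab) hlim').mono Icc_subset_Iic_self
  · exact (hint y ⟨hya, hyb⟩).hasDerivWithinAt

/-- The derivative within `[a, b]` of the series is the series of the derivatives, on `[a, b]`. [folklore] -/
theorem derivWithin_tsum_eqOn (hab : a < b) (h : DominatedSmoothFamily a b f v) :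
    Set.EqOn (_root_.derivWithin (fun z => ∑' i, f i z) (Set.Icc a b))
      (fun y => ∑' i, _root_.derivWithin (f i) (Set.Icc a b) y) (Set.Icc a b) :=
  fun y hy => (h.hasDerivWithinAt_tsum hab y hy).derivWithin (uniqueDiffOn_Icc hab y hy)

end DominatedSmoothFamily

/-- **`C^∞` UNDER THE SUM ON A CLOSED INTERVAL.**  The series of a dominated smooth family on `[a, b]`, `a < b`, is `C^n` on
`[a, b]` for every `n : ℕ` (in the sense `ContDiffOn ℝ n · (Set.Icc a b)` of `Step.SFHyp.betaSmooth`).  Induction on `n`: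
`C^{n+1}` on a set of unique differentiability = differentiable + derivative `C^n` (`contDiffOn_succ_iff_derivWithin`); the
derivative within `[a, b]` is the series of the derivatives (`hasDerivWithinAt_tsum`), again a dominated smooth family. [folklore] -/
theorem contDiffOn_tsum_Icc (hab : a < b) :
    ∀ (n : ℕ) {f : ι → ℝ → ℝ} {v : ℕ → ι → ℝ}, DominatedSmoothFamily a b f v →
      ContDiffOn ℝ n (fun z => ∑' i, f i z) (Set.Icc a b) := by
  intro n
  induction n with
  | zero =>
    intro f v h
    rw [Nat.cast_zero, contDiffOn_zero]
    exact h.continuousOn_tsum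
  | succ n IH =>
    intro f v h
    have hs : UniqueDiffOn ℝ (Set.Icc a b) := uniqueDiffOn_Icc hab
    rw [Nat.cast_succ, contDiffOn_succ_iff_derivWithin hs]
    refine ⟨fun y hy => (h.hasDerivWithinAt_tsum hab y hy).differentiableWithinAt,
      fun htop => absurd htop (WithTop.natCast_ne_top n), ?_⟩
    exact (IH (h.derivFamily hab)).congr (h.derivWithin_tsum_eqOn hab)

/-- **`∂^m Σ = Σ ∂^m` ON `[a, b]`.**  For a dominated smooth family, the `m`-th derivative within `[a, b]` of the series is
the series of the `m`-th derivatives, at every point of `[a, b]`. [folklore] -/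
theorem iteratedDerivWithin_tsum_Icc (hab : a < b) :
    ∀ (m : ℕ) {f : ι → ℝ → ℝ} {v : ℕ → ι → ℝ}, DominatedSmoothFamily a b f v →
      ∀ y ∈ Set.Icc a b, iteratedDerivWithin m (fun z => ∑' i, f i z) (Set.Icc a b) y
        = ∑' i, iteratedDerivWithin m (f i) (Set.Icc a b) y := by
  intro m
  induction m with
  | zero =>
    intro f v h y hy
    simp only [iteratedDerivWithin_zero]
  | succ m IH =>
    intro f v h y hy
    rw [iteratedDerivWithin_succ', iteratedDerivWithin_congr (h.derivWithin_tsum_eqOn hab) hy,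
      IH (h.derivFamily hab) y hy]
    exact tsum_congr (fun i => by rw [iteratedDerivWithin_succ'])

/-- **DOMINATED BOUND ON EVERY DERIVATIVE.**  `|∂^m (Σ_i f i)(y)| ≤ Σ_i v m i` on `[a, b]`. [folklore] -/
theorem abs_iteratedDerivWithin_tsum_le (hab : a < b) (m : ℕ) {f : ι → ℝ → ℝ} {v : ℕ → ι → ℝ}
    (h : DominatedSmoothFamily a b f v) :
    ∀ y ∈ Set.Icc a b, |iteratedDerivWithin m (fun z => ∑' i, f i z) (Set.Icc a b) y| ≤ ∑' i, v m i := by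
  intro y hy
  rw [iteratedDerivWithin_tsum_Icc hab m h y hy, ← Real.norm_eq_abs]
  exact tsum_of_norm_bounded (h.summable m).hasSum (fun i => by rw [Real.norm_eq_abs]; exact h.bound m i y hy)

/-- **MEAN VALUE ON `[0, γ]`.**  A `C¹` function on `[0, γ]`, `γ > 0`, whose first derivative within `[0, γ]` is bounded by `C`
satisfies `|β(x) − β(0)| ≤ C·x` on `[0, γ]` — the shape of the remainder hypothesis (AF-1) `|r_j(x)| ≤ C x` of
`B12Beta.betaLower_of_split` with `r_j(x) = β_j(x) − β_j(0)` (cell GAPS.md G-b12-1). [folklore] -/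
theorem lipschitzAtZero_of_derivBound {β : ℝ → ℝ} {γ C : ℝ} (hγ : 0 < γ) (hβ : ContDiffOn ℝ 1 β (Set.Icc 0 γ))
    (hC : ∀ x ∈ Set.Icc (0:ℝ) γ, |iteratedDerivWithin 1 β (Set.Icc 0 γ) x| ≤ C) :
    ∀ x ∈ Set.Icc (0:ℝ) γ, |β x - β 0| ≤ C * x := by
  intro x hx
  have h := Convex.norm_image_sub_le_of_norm_derivWithin_le (hβ.differentiableOn one_ne_zero)
    (fun y hy => by rw [Real.norm_eq_abs, ← iteratedDerivWithin_one]; exact hC y hy)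
    (convex_Icc 0 γ) (Set.left_mem_Icc.mpr hγ.le) hx
  rw [Real.norm_eq_abs, Real.norm_eq_abs, sub_zero, abs_of_nonneg hx.1] at h
  exact h

end SmoothSeries

/-! ## Part 1 — the printed g-regularity clauses over the small-field tower -/

section Clauses

variable {P : Params} {G : Type*} [GaugeGroup G] {Φ 𝒢 : Type*}

/-- **B12 p. 263 [PDF 15], VERBATIM** (inductive description of the localized terms, right before (1.18)): *"Let us come
back to the description of the actions. We assume that the function E^{(j)}(X, g_{j−1}, 𝐔, 𝐉) is defined and analytic on the
space U^c_j(X, α₀, α₁), with some positive, absolute constants α₀, α₁ (i.e., constants independent of X and j). It depends on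
the configurations restricted to X, i.e. on (𝐔, 𝐉)|_X. It is a C^∞-function of g_{j−1} ∈ [0, γ], (or analytic), with a
positive, absolute γ."* — the C^∞-in-g clause, for the terms `j = 1, …, k` of the tower and configurations in the
analyticity domain, in the shape of the clauses of `Step.SFHyp T c k` (which omits it: cell GAPS.md G-adv2-6 (i), G-b12-2 (i);
DIVERGENCE D-f2.1).  A hypothesis, never asserted. [cite: Balaban1987RG1, p.263 (clause before (1.18))] -/
def ESmoothHyp (T : SFTower P G Φ 𝒢) (c : SFConsts) (k : ℕ) : Prop :=
  ∀ j, 1 ≤ j → j ≤ k → ∀ X φ, φ ∈ T.space j X c.α₀ c.α₁ →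
    ∀ n : ℕ, ContDiffOn ℝ n (fun g => T.E j X g φ) (Set.Icc 0 c.γ)

/-- The same clause AT THE NEW INDEX `j = k+1` — what the step `k → k+1` of B12 Theorem 3 (p. 264) must deliver for the new
term `E^{(k+1)}(X, g_k, 𝐔, 𝐉)` of (2.13), in the shape of a `Step.SFNewTerm T c k` clause; NOT among the properties the
reduction sentence p. 269 (*"reduced to … a construction of the representation (1.7) with terms having the analytic
extensions satisfying the bound (1.18)"*) retains, and not mentioned in [II] pp. 19–22 (GAPS G-b12-2 (i), G-adv2-6 (i)).
[cite: Balaban1987RG1, p.263 (clause before (1.18)) with Thm 3 p.264] -/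
def ESmoothAt (T : SFTower P G Φ 𝒢) (c : SFConsts) (k : ℕ) : Prop :=
  ∀ X φ, φ ∈ T.space (k+1) X c.α₀ c.α₁ → ∀ n : ℕ, ContDiffOn ℝ n (fun g => T.E (k+1) X g φ) (Set.Icc 0 c.γ)

/-- Cumulative bookkeeping (as `Step.SFHyp.succ_iff`): the clause for the terms `1, …, k+1` is the clause for `1, …, k` plus
the clause at the new index. [folklore] -/
theorem eSmoothHyp_succ_iff {T : SFTower P G Φ 𝒢} {c : SFConsts} {k : ℕ} :
    ESmoothHyp T c (k+1) ↔ ESmoothHyp T c k ∧ ESmoothAt T c k := by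
  constructor
  · intro h
    exact ⟨fun j h1 hj => h j h1 (Nat.le_succ_of_le hj), fun X φ hφ => h (k+1) k.succ_pos le_rfl X φ hφ⟩
  · rintro ⟨h, hn⟩ j h1 hj X φ hφ
    rcases Nat.lt_or_ge j (k+1) with hj' | hj'
    · exact h j h1 (Nat.lt_succ_iff.mp hj') X φ hφ
    · have : j = k + 1 := le_antisymm hj hj'
      subst this
      exact hn X φ hφ

/-- **UNPRINTED — LOCATED OPEN INPUT (a).**  The inductive bound (1.18) p. 263 (*"|E^{(j)}(X, g_{j−1}, 𝐔, 𝐉)| ≤ E₀ exp(−κ d_j(X))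
… for all configurations (𝐔, 𝐉) ∈ U^c_j(X, α₀, α₁)"*) STRENGTHENED TO ALL g-DERIVATIVES: for every order `n`, every term
`j = 1, …, k`, every configuration in the analyticity domain and every `g ∈ [0, γ]`,
`‖∂ⁿ_g E^{(j)}(X, g, 𝐔, 𝐉)‖ ≤ E₀,ₙ exp(−κ d_j(X))` (derivatives within `[0, γ]`), with constants `E₀,ₙ` independent of `j`, `X`
and the configuration.  This is the *"inductive clause bounding ∂ⁿ_g E^{(j)}(X)"* that cell GAPS.md G-adv2-6 / G-b12-2 name as
NEEDED for the p. 264 β-clause and that is printed NOWHERE in [I]–[II] (p. 263 asserts only C^∞ in g, with no bound on the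
derivatives; §5 and [II] pp. 19–22 prove no g-derivative bound).  A hypothesis; its `n = 0` instance is (1.18) itself
(`bound118_of_derivBound`). [cite: Balaban1987RG1, (1.18) p.263 (the n = 0 case; n ≥ 1 unprinted)] -/
def EDerivBound118 (T : SFTower P G Φ 𝒢) (c : SFConsts) (E₀n : ℕ → ℝ) (k : ℕ) : Prop :=
  ∀ j, 1 ≤ j → j ≤ k → ∀ (n : ℕ) X φ, φ ∈ T.space j X c.α₀ c.α₁ → ∀ g ∈ Set.Icc (0:ℝ) c.γ,
    ‖iteratedDerivWithin n (fun g' => T.E j X g' φ) (Set.Icc 0 c.γ) g‖ ≤ E₀n n * Real.exp (-c.κ * (T.sys j).dj X)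

/-- The `n = 0` instance of `EDerivBound118` is exactly the clause `Step.SFHyp.bound118` ((1.18) p. 263) when `E₀,₀ = E₀`
— so `EDerivBound118` is a genuine strengthening of the printed inductive bound, not a different statement. [cite: Balaban1987RG1, (1.18) p.263] -/
theorem bound118_of_derivBound {T : SFTower P G Φ 𝒢} {c : SFConsts} {E₀n : ℕ → ℝ} {k : ℕ}
    (h : EDerivBound118 T c E₀n k) (h0 : E₀n 0 = c.E₀) :
    ∀ j, 1 ≤ j → j ≤ k → ∀ X g φ, 0 ≤ g → g ≤ c.γ → φ ∈ T.space j X c.α₀ c.α₁ →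
      ‖T.E j X g φ‖ ≤ c.E₀ * Real.exp (-c.κ * (T.sys j).dj X) := by
  intro j h1 hj X g φ hg0 hgγ hφ
  have := h j h1 hj 0 X φ hφ g ⟨hg0, hgγ⟩
  rwa [iteratedDerivWithin_zero, h0] at this

/-- **B12 p. 266 [PDF 18], VERBATIM** (after (2.9)): *"Another possibility is to take g_k/γ_k ε₁ instead of ε₁, where
γ_k = C log(L^k ε)^{−1} with C sufficiently large. It has the advantage that the functions E^{(j)}, β_j are analytic functions of
the effective coupling constants, but it has some disadvantages in perturbative calculations also. We have formulated the
implications of both possibilities in the inductive description."* — the "(or analytic)" alternative of the p. 263 clause AT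
THE NEW INDEX, typed as real analyticity WITHIN `[0, γ]` (Mathlib `AnalyticOn`: at each point of `[0, γ]` the function agrees,
within `[0, γ]`, with a convergent power series — the weakest faithful reading; print does not specify a complex neighbourhood).
A hypothesis. [cite: Balaban1987RG1, p.266 (paragraph after (2.9)) with p.263] -/
def EAnalyticAt (T : SFTower P G Φ 𝒢) (c : SFConsts) (k : ℕ) : Prop :=
  ∀ X φ, φ ∈ T.space (k+1) X c.α₀ c.α₁ → AnalyticOn ℝ (fun g => T.E (k+1) X g φ) (Set.Icc 0 c.γ)

/-- The "(or analytic)" alternative of the p. 264 β-clause (*"It is a smooth function defined on the interval [0, γ], (or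
analytic)"*; p. 266 *"the functions E^{(j)}, β_j are analytic functions of the effective coupling constants"*) at the new index:
`β_{k+1}` real analytic within `[0, γ]`.  A hypothesis. [cite: Balaban1987RG1, p.264 (β-clause after (1.22)) with p.266] -/
def BetaAnalyticAt (T : SFTower P G Φ 𝒢) (c : SFConsts) (k : ℕ) : Prop :=
  AnalyticOn ℝ (T.flow.β (k+1)) (Set.Icc 0 c.γ)

/-- "(or analytic)" ⇒ "C^∞" for the new term: on `[0, γ]` with `γ > 0` (a set of unique differentiability) within-set
analyticity gives `ContDiffOn ℝ n` for every `n` (Mathlib `AnalyticOn.contDiffOn`). [folklore] -/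
theorem eSmoothAt_of_analytic {T : SFTower P G Φ 𝒢} {c : SFConsts} {k : ℕ} (hγ : 0 < c.γ) (h : EAnalyticAt T c k) :
    ESmoothAt T c k :=
  fun X φ hφ _ => (h X φ hφ).contDiffOn (uniqueDiffOn_Icc hγ)

/-- "(or analytic)" ⇒ "smooth" for `β_{k+1}`: `BetaAnalyticAt ⇒ B12StepObligation.BetaSmoothAt` (`γ > 0`). [folklore] -/
theorem betaSmoothAt_of_analytic {T : SFTower P G Φ 𝒢} {c : SFConsts} {k : ℕ} (hγ : 0 < c.γ)
    (h : BetaAnalyticAt T c k) : BetaSmoothAt T c k :=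
  fun _ => h.contDiffOn (uniqueDiffOn_Icc hγ)

/-! ## Part 2 — the located open input on the vacuum-polarization kernel, and the kernel-checked chain to the β-clause -/

/-- **UNPRINTED — LOCATED OPEN INPUT (b): the §5 source of β EXTENDED BY g-REGULARITY.**  `B12StepObligation.Beta542Source T c k`
((5.42) p. 297 = (1.22) p. 264: `β_{k+1}(g) = Σ_x Π^{(k+1)}_{μν}(g, x) x_μ x_ν`, one component kernel `Pk g` per value `g` of the
coupling; (5.10) p. 293: `|Π_{μν}(g, x)| ≤ C e^{−δ₁|x|₁}` for `g ∈ [0, γ]`; `betaPrime510 ≤ β′`) PLUS: for every lattice point `x`,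
`g ↦ Π^{(k+1)}_{μν}(g, x)` is `C^n` on `[0, γ]` for every `n` (`smooth`), and every g-derivative obeys a (5.10)-type bound
`|∂ⁿ_g Π^{(k+1)}_{μν}(g, x)| ≤ Cₙ e^{−δ₁|x|₁}` uniformly in `g ∈ [0, γ]` (`decayDeriv`), with constants `Cₙ` (fields, hence
independent of `k` only in so far as the instantiating reader makes them so — TYPING NOTE (2)).  In print: (1.20) p. 264 defines
`Π^{ab}_{j+1,μν}(g_j, x, x′) = (δ²/δB^a_μ(x) δB^b_ν(x′) E^{(j+1)})(g_j, 0)`, (1.21) takes the limit `T^{(j+1)} ↗ ℤ^d` (*"This limit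
exists by the localized representation (1.7)"*), and NOTHING is said or proved about the g-dependence of Π ((5.10) p. 293, *"The
representation (4.37) yields the following inequality"*, is the `n = 0` bound, asserted not derived; GAPS G-B12s-15, G-pv13-4).  Data + hypotheses, never asserted; what would produce it
from Part 1's `EDerivBound118` is the untyped hypothesis `PolarizationDerivTransfer`. [cite: Balaban1987RG1, (1.20)–(1.22) p.264 with (5.10) p.293 (g-derivatives unprinted)] -/
structure PiSmoothSource (T : SFTower P G Φ 𝒢) (c : SFConsts) (k : ℕ) extends Beta542Source T c k where
  Cn : ℕ → ℝ
  smooth : ∀ (x : Fin d → ℤ) (n : ℕ), ContDiffOn ℝ n (fun g => Pk g μ ν x) (Set.Icc 0 c.γ)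
  decayDeriv : ∀ (n : ℕ) (x : Fin d → ℤ), ∀ g ∈ Set.Icc (0:ℝ) c.γ,
    |iteratedDerivWithin n (fun g' => Pk g' μ ν x) (Set.Icc 0 c.γ) g| ≤ Cn n * Real.exp (-δ₁ * B12Sec2to5.l1 x)

namespace PiSmoothSource

variable {T : SFTower P G Φ 𝒢} {c : SFConsts} {k : ℕ}

/-- The summands of (1.22)/(5.42) as a g-dependent family indexed by the lattice: `f x g = Π(g, x) x_μ x_ν`. [cite: Balaban1987RG1, (1.22) p.264] -/
def term (S : PiSmoothSource T c k) (x : Fin S.d → ℤ) (g : ℝ) : ℝ :=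
  S.Pk g S.μ S.ν x * (x S.μ : ℝ) * (x S.ν : ℝ)

/-- The dominating sequences: `v n x = Cₙ · |x|₁² e^{−δ₁|x|₁}` (summable on `ℤ^d` by `B12Sec2to5.majorant_summable`). [folklore] -/
noncomputable def major (S : PiSmoothSource T c k) (n : ℕ) (x : Fin S.d → ℤ) : ℝ :=
  S.Cn n * (B12Sec2to5.l1 x ^ 2 * Real.exp (-S.δ₁ * B12Sec2to5.l1 x))

/-- (1.22) read through the source: on `[0, γ]`, `β_{k+1}(g) = Σ_x f x g`. [cite: Balaban1987RG1, (1.22) p.264 / (5.42) p.297] -/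
theorem beta_eq_tsum (S : PiSmoothSource T c k) {g : ℝ} (hg : g ∈ Set.Icc (0:ℝ) c.γ) :
    T.flow.β (k+1) g = ∑' x, S.term x g := by
  rw [S.beta_eq g hg.1 hg.2]
  rfl

/-- The summands of (1.22) form a DOMINATED SMOOTH FAMILY on `[0, γ]`: termwise smoothness from `smooth`, domination of the
`m`-th g-derivative of `Π(g, x) x_μ x_ν` by `C_m |x|₁² e^{−δ₁|x|₁}` from `decayDeriv` (pointwise step =
`B12Sec2to5.abs_term_le_of_decay510` applied to the kernel `x ↦ ∂^m_g Π(g, x)`), summability = `B12Sec2to5.majorant_summable`. [folklore] -/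
theorem dominated (S : PiSmoothSource T c k) : DominatedSmoothFamily 0 c.γ S.term S.major where
  summable := fun m => (B12Sec2to5.majorant_summable S.δ₁_pos S.d).mul_left (S.Cn m)
  smooth := fun x m => ((S.smooth x m).mul contDiffOn_const).mul contDiffOn_const
  bound := fun m x g hg => by
    have hfun : S.term x = fun g' => ((x S.μ : ℝ) * (x S.ν : ℝ)) * S.Pk g' S.μ S.ν x := by
      funext g'; simp only [term]; ring
    have hdec : B12Sec2to5.Decay510 (fun y : Fin S.d → ℤ =>
        iteratedDerivWithin m (fun g' => S.Pk g' S.μ S.ν y) (Set.Icc 0 c.γ) g) (S.Cn m) S.δ₁ :=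
      fun y => S.decayDeriv m y g hg
    have h := B12Sec2to5.abs_term_le_of_decay510 hdec S.μ S.ν x
    rw [hfun, iteratedDerivWithin_const_mul_field]
    calc |(x S.μ : ℝ) * (x S.ν : ℝ) * iteratedDerivWithin m (fun g' => S.Pk g' S.μ S.ν x) (Set.Icc 0 c.γ) g|
        = |iteratedDerivWithin m (fun g' => S.Pk g' S.μ S.ν x) (Set.Icc 0 c.γ) g * (x S.μ : ℝ) * (x S.ν : ℝ)| := by
          ring_nf
      _ ≤ S.Cn m * (B12Sec2to5.l1 x ^ 2 * Real.exp (-S.δ₁ * B12Sec2to5.l1 x)) := h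

/-- The bounds `Σ_x v n x = Cₙ · Σ_x |x|₁² e^{−δ₁|x|₁} = betaPrime510 d Cₙ δ₁`. [folklore] -/
theorem tsum_major (S : PiSmoothSource T c k) (n : ℕ) :
    ∑' x, S.major n x = B12Sec2to5.betaPrime510 S.d (S.Cn n) S.δ₁ := by
  unfold major B12Sec2to5.betaPrime510
  rw [tsum_mul_left]

end PiSmoothSource

/-- **KERNEL: the smoothness half of the p. 264 β-clause from the located Π-input.**  If the vacuum-polarization kernels of the
new term are smooth in `g` with (5.10)-type decay of every g-derivative (`PiSmoothSource`) and `γ > 0`, then `β_{k+1}` is `C^n`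
on `[0, γ]` for every `n` — i.e. `B12StepObligation.BetaSmoothAt T c k`, the shape of `Step.SFNewTerm.betaSmooth`, the ONE
clause of the step obligation that `B12StepObligation.sfNewTerm_of_bound` had to take unsourced (GAPS C-B12s-E1).  Proof:
differentiation under the lattice sum (1.22) on the closed interval (`contDiffOn_tsum_Icc`).  This does NOT source the clause
in print: it moves the open input from β to Π (and, via `PolarizationDerivTransfer`, to the g-derivatives of `E^{(k+1)}`).
[cite: Balaban1987RG1, p.264 (β-clause after (1.22))] -/
theorem betaSmoothAt_of_piSmooth {T : SFTower P G Φ 𝒢} {c : SFConsts} {k : ℕ} (hγ : 0 < c.γ)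
    (S : PiSmoothSource T c k) : BetaSmoothAt T c k := by
  intro n
  exact (contDiffOn_tsum_Icc hγ n S.dominated).congr (fun g hg => S.beta_eq_tsum hg)

/-- **THE DERIVATIVE HALF OF THE β-CLAUSE, TYPED.**  p. 264 [PDF 16], verbatim, of `β_{j+1}`: *"It is a smooth function defined
on the interval [0, γ], (or analytic), uniformly bounded on this interval together with all derivatives."* — the clause
"together with all derivatives" at the new index: for every order `n`, `|∂ⁿ_g β_{k+1}(g)| ≤ β′ₙ` on `[0, γ]` (derivatives within
`[0, γ]`), for a sequence of constants `β′ₙ`.  The cell's `Step.SFHyp` types only `n = 0` (`betaBound`, constant `β′`) and the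
qualitative smoothness (`betaSmooth`); the derivative bounds were left untyped for want of a consumer (DIVERGENCE D-f2.5, which
prescribes exactly this shape).  A hypothesis / target shape, never asserted. [cite: Balaban1987RG1, p.264 (β-clause after (1.22))] -/
def BetaDerivBoundsAt (T : SFTower P G Φ 𝒢) (c : SFConsts) (k : ℕ) (β'n : ℕ → ℝ) : Prop :=
  ∀ n : ℕ, ∀ g ∈ Set.Icc (0:ℝ) c.γ, |iteratedDerivWithin n (T.flow.β (k+1)) (Set.Icc 0 c.γ) g| ≤ β'n n

/-- `n = 0` of `BetaDerivBoundsAt` is the clause `betaBound` at the new index (with `β′ = β′₀`). [folklore] -/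
theorem betaBound_of_derivBounds {T : SFTower P G Φ 𝒢} {c : SFConsts} {k : ℕ} {β'n : ℕ → ℝ}
    (h : BetaDerivBoundsAt T c k β'n) (h0 : β'n 0 ≤ c.β') :
    ∀ x ∈ Set.Icc (0:ℝ) c.γ, |T.flow.β (k+1) x| ≤ c.β' := by
  intro x hx
  have := h 0 x hx
  rw [iteratedDerivWithin_zero] at this
  exact this.trans h0

/-- **KERNEL: the derivative bounds from the located Π-input, with explicit constants.**  Under `PiSmoothSource` and `γ > 0`:
`|∂ⁿ_g β_{k+1}(g)| ≤ Cₙ · Σ_{x ∈ ℤ^d} |x|₁² e^{−δ₁|x|₁} = betaPrime510 d Cₙ δ₁` on `[0, γ]`, for every `n` — the derivative version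
of `B12StepObligation.betaBound_of_beta542` / `B12Sec2to5.secondMoment_abs_le_of_decay510` (`∂ⁿ Σ = Σ ∂ⁿ` on the closed
interval, `iteratedDerivWithin_tsum_Icc`, then dominated summation).  Constants depend on `Cₙ, δ₁, d` only. [cite: Balaban1987RG1, p.264 (β-clause) with (5.10) p.293, (5.42) p.297] -/
theorem betaDerivBounds_of_piSmooth {T : SFTower P G Φ 𝒢} {c : SFConsts} {k : ℕ} (hγ : 0 < c.γ)
    (S : PiSmoothSource T c k) :
    BetaDerivBoundsAt T c k (fun n => B12Sec2to5.betaPrime510 S.d (S.Cn n) S.δ₁) := by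
  intro n g hg
  have hEq : Set.EqOn (T.flow.β (k+1)) (fun g' => ∑' x, S.term x g') (Set.Icc 0 c.γ) :=
    fun g' hg' => S.beta_eq_tsum hg'
  show |iteratedDerivWithin n (T.flow.β (k+1)) (Set.Icc 0 c.γ) g| ≤ B12Sec2to5.betaPrime510 S.d (S.Cn n) S.δ₁
  rw [iteratedDerivWithin_congr hEq hg, ← S.tsum_major n]
  exact abs_iteratedDerivWithin_tsum_le hγ n S.dominated g hg

/-- **KERNEL: the (AF-1)-shaped consequence.**  Under `PiSmoothSource` and `γ > 0`: `|β_{k+1}(g) − β_{k+1}(0)| ≤ β′₁ · g` on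
`[0, γ]` with `β′₁ = betaPrime510 d C₁ δ₁` (mean value theorem on `[0, γ]` + the first-derivative bound) — the shape of the
remainder hypothesis of `B12Beta.betaLower_of_split` (Markov typing, `r_j(x) = β_j(x) − β_j(0)`), i.e. of (AF-1) of GAPS G-b12-1,
whose other half (AF-0) — the SIGN of `β_{k+1}(0) = β⁰_{k+1}` — is untouched by anything in this module.
[cite: Balaban1987RG1, p.264 (β-clause after (1.22))] -/
theorem betaLipschitzAtZero_of_piSmooth {T : SFTower P G Φ 𝒢} {c : SFConsts} {k : ℕ} (hγ : 0 < c.γ)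
    (S : PiSmoothSource T c k) :
    ∀ g ∈ Set.Icc (0:ℝ) c.γ,
      |T.flow.β (k+1) g - T.flow.β (k+1) 0| ≤ B12Sec2to5.betaPrime510 S.d (S.Cn 1) S.δ₁ * g :=
  lipschitzAtZero_of_derivBound hγ (by exact_mod_cast betaSmoothAt_of_piSmooth hγ S 1)
    (fun x hx => betaDerivBounds_of_piSmooth hγ S 1 x hx)

/-- The Π-input FORGETS to the §5 source of the plain bound: `PiSmoothSource ⇒ Beta542Source` (the parent structure), so
`B12StepObligation.betaBound_of_beta542` applies unchanged. [folklore] -/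
theorem betaBound_of_piSmooth {T : SFTower P G Φ 𝒢} {c : SFConsts} {k : ℕ} (S : PiSmoothSource T c k) :
    ∀ x ∈ Set.Icc (0:ℝ) c.γ, |T.flow.β (k+1) x| ≤ c.β' :=
  betaBound_of_beta542 S.toBeta542Source

/-- **UNPRINTED — THE UNTYPED LAYER, NAMED.**  The passage from g-derivative bounds on the localized terms of the new action
(`ESmoothAt` + `EDerivBound118` at the terms `j ≤ k+1`, Part 1) to g-derivative bounds on the vacuum-polarization kernel
(`PiSmoothSource`, Part 2): in print this is (1.20) p. 264 (`Π = δ²E^{(k+1)}/δB δB` at `B = 0`, a Cauchy estimate on the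
analyticity domain `U^c_{k+1}(X, α₀, α₁)` — cf. (4.37) p. 290 / (5.10) p. 293 for the `n = 0` case, *"The representation (4.37)
yields the following inequality"*) followed by
the infinite-volume limit of (1.21) (*"This limit exists by the localized representation (1.7)"*), both of which would have to
COMMUTE with `∂ⁿ_g` and PRESERVE the uniform constants.  Neither the variational derivative in `B` (no linear structure on the
abstract configuration type `Φ` of `Step.SFTower`, DIVERGENCE D-f2.1) nor the limit `T^{(k+1)} ↗ ℤ^d` (no family of tori in the
tower) is typed in this package, so the layer is ONE NAMED HYPOTHESIS: "the strengthened inductive clauses at the terms up to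
`k+1` yield a Π-source at step `k`".  It is proved nowhere in [I] (§5 asserts the `n = 0` decay (5.10) and treats no g-derivative) nor in [II] (pp. 19–22 do not discuss
the g-dependence of E^{(k+1)}; GAPS G-adv2-6); together with `EDerivBound118` it is the precise open statement of what B12/B13
would have to carry through the induction for the β-clause of p. 264.  [cite: Balaban1987RG1, (1.20)–(1.21) p.264 with (5.9)–(5.10) p.293 (g-derivative transfer unprinted)] -/
def PolarizationDerivTransfer (T : SFTower P G Φ 𝒢) (c : SFConsts) (E₀n : ℕ → ℝ) (k : ℕ) : Prop :=
  ESmoothHyp T c (k+1) → EDerivBound118 T c E₀n (k+1) → Nonempty (PiSmoothSource T c k)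

/-- **END TO END (kernel-checked composition; every input a named hypothesis).**  IF the localized terms up to the new index are
C^∞ in `g ∈ [0, γ]` (p. 263 clause, `ESmoothHyp T c (k+1)`) with the strengthened inductive bound on all g-derivatives
(`EDerivBound118`, unprinted), AND the (1.20)–(1.21) layer transports these to the polarization kernel
(`PolarizationDerivTransfer`, unprinted and untyped in content), AND `γ > 0` — THEN the two β-clauses of the step obligation hold
at the new index: `BetaSmoothAt T c k` (smoothness, the unsourced clause of GAPS C-B12s-E1) and the plain bound `betaBound`,
TOGETHER WITH bounds on all derivatives (`BetaDerivBoundsAt`, D-f2.5) for some sequence of constants.  Value: the p. 264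
β-clause is thereby LOCATED at two precise unprinted statements about `E^{(j)}` and Π; nothing of the series is asserted.
[cite: Balaban1987RG1, p.264 (β-clause after (1.22)) with p.263, (1.20)–(1.21)] -/
theorem betaClauses_of_transfer {T : SFTower P G Φ 𝒢} {c : SFConsts} {E₀n : ℕ → ℝ} {k : ℕ} (hγ : 0 < c.γ)
    (htr : PolarizationDerivTransfer T c E₀n k) (hE : ESmoothHyp T c (k+1)) (hD : EDerivBound118 T c E₀n (k+1)) :
    BetaSmoothAt T c k ∧ (∀ x ∈ Set.Icc (0:ℝ) c.γ, |T.flow.β (k+1) x| ≤ c.β') ∧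
      ∃ β'n : ℕ → ℝ, BetaDerivBoundsAt T c k β'n := by
  obtain ⟨S⟩ := htr hE hD
  exact ⟨betaSmoothAt_of_piSmooth hγ S, betaBound_of_piSmooth S, ⟨_, betaDerivBounds_of_piSmooth hγ S⟩⟩

/-- Corollary in the vocabulary of `B12StepObligation`: with the Π-input in hand, the per-step deliverable
`Step.SFNewTerm T c k` is assembled by `sfNewTerm_of_bound` WITHOUT the separate unsourced hypothesis `BetaSmoothAt` — it is
now supplied by `betaSmoothAt_of_piSmooth` (and `Beta542Source` by the parent projection).  Bookkeeping only; the open input has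
moved from β to Π, not disappeared. [cite: Balaban1988RG2Cluster, p.22 ("completes the proof of the inductive assumptions for the action A_{k+1}")] -/
theorem sfNewTerm_of_bound_piSmooth {T : SFTower P G Φ 𝒢} {c : SFConsts} {k : ℕ} {S₂ : ℝ → B13.StepData}
    (Δ : StepDict T c k S₂) {E₀' κ' : ℝ} (hE₀ : E₀' ≤ c.E₀) (hE₀' : 0 ≤ E₀') (hκ : c.κ ≤ κ') (hκ0 : 0 ≤ c.κ)
    (hbound : ∀ g, 0 ≤ g → g ≤ c.γ → B13.Bound118 (S₂ g).Dk1 (S₂ g).sp2 (Δ.F g) E₀' κ')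
    (hrepr : ∀ g, (S₂ g).Repr17) (hgauge : ∀ g X, (S₂ g).GaugeInv (Δ.F g X))
    (hrg : 1 / (T.flow.g k) ^ 2 = 1 / (T.flow.g (k+1)) ^ 2 + T.flow.β (k+1) (T.flow.g k))
    (hsp : SpacesGaugeInvariant T c (k+1)) (hγ : 0 < c.γ) (S : PiSmoothSource T c k) :
    SFNewTerm T c k :=
  sfNewTerm_of_bound Δ hE₀ hE₀' hκ hκ0 hbound hrepr hgauge hrg hsp S.toBeta542Source (betaSmoothAt_of_piSmooth hγ S)

end Clauses

end Literature.MathematicalPhysics.QuantumFieldTheory.Balaban1983to89.B12BetaSmooth
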